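import Literature.Geometry.Riemannian.MetricFlowSliceUnionBounds
import Literature.Geometry.Riemannian.MassDistribution
import HarnessLib

/-!
# Geometric closeness of nearby time-slices (Bamler 2023, §4.2, Proposition)

R. Bamler, *Compactness theory of the space of super Ricci flows*, Invent. Math. 233 (2023), §4.2,
Proposition (closeness of nearby time-slices): for an `H`-concentrated metric flow with a
conjugate heat flow `(μ_t)`, times `s ≤ t` in `I'` and (after parabolic rescaling) `r = 1`, if
`b^{(𝒳_t, d_t, μ_t)}_1 ≥ b` on `[δ, 1]`, `t − s ≤ δ`, `Var(μ_t) ≤ V` and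
`∫∫ d_t dμ_t dμ_t − ∫∫ d_s dμ_s dμ_s ≤ δ`, then for `δ ≤ δ(H, V, b, ε)` there is a closed
`W ⊆ 𝒳_t` with (a) `μ_t(𝒳_t ∖ W) ≤ ε`, (b) `0 ≤ d_t(y₁, y₂) − d_{W₁}(ν_{y₁;s}, ν_{y₂;s}) ≤ ε` on
`W`, and (c)–(e): a metric space `Z ⊇ 𝒳_s, 𝒳_t` with `d_Z(φ_s x, φ_t y) ≤ d_{W₁}(δ_x, ν_{y;s}) + ε`
on `W`, the coupling `q = ∫ ν_{y;s} ⊗ δ_y dμ_t(y)` with `∫ d_Z dq ≤ ε`, and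
`d_{GW₁}((𝒳_s, d_s, μ_s), (𝒳_t, d_t, μ_t)) ≤ ε`. Printed proof: `W := {y : μ_t(D(y, ζ)) ≥ b(ζ)}`,
so `μ_t(𝒳_t ∖ W) ≤ ζ`; (b) from the distance-distortion Lemma (4.6) with `r = ζ`; (c)–(e) from the
Lemma (construction of `Z`).

We assemble it from the tree's (4.6) (`MetricFlowDistanceDistortion.lean`), the space
`Z = 𝒳_s ⊔ 𝒳_t` (`MetricFlowSliceUnion.lean`), (d), (e) (`MetricFlowSliceGW1.lean`) and (4.8)
(`MetricFlowSliceUnionBounds.lean`), in QUANTITATIVE form (explicit constants instead of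
`δ(H, V, b, ε)`), with the mass hypothesis at the single scale `ζ` that the proof uses,
`μ_t({y : μ_t(D(y, ζ)) < β}) ≤ ζ` (i.e. `b^{(𝒳_t,d_t,μ_t)}_1(ζ) ≥ β`, `le_massDistribution_iff`):

* `MetricFlow.goodSet` — `W := {y : μ_t(D(y, ζ)) ≥ β}`; `measure_compl_goodSet_le` — **(a)**;
* `MetricFlow.IsHConcentrated.edist_le_wassersteinW1_add_of_mem_goodSet` — **(b)** with the
  constant `C(H, δ, ζ, β) := ((δ/(2ζ) + 3√(Hδ/(4ζ²)))/β² + 4)·2ζ` ((4.6) with `r = 2ζ`,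
  `α = δ/(4ζ²)`, `γ = β²`);
* `MetricFlow.IsHConcentrated.gromovW1_slice_le` — **(e)** (through (c), (d), (4.8)):
  `d_{GW₁}((𝒳_s, μ_s), (𝒳_t, μ_t)) ≤ Ψ(H, V, η)`, `η := max(C, δ, ζ) ≤ 1/2`, with the explicit
  `Ψ` of (4.8).

Everything is proved; the only definition is `W`; no named facts.

## References

* R. H. Bamler, *Compactness theory of the space of super Ricci flows*, Invent. Math. 233 (2023),
  §4.2, Proposition (closeness of nearby time-slices), (a)–(e), (4.5)–(4.8). [Bamler2023]
-/

noncomputable section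

open Set MeasureTheory ProbabilityTheory Filter Topology Metric
open scoped ENNReal NNReal

namespace Literature.Geometry.Riemannian

universe u

namespace MetricFlow

variable {I : Set ℝ} {𝒳 : MetricFlow.{u} I}

/-- **The good set `W := {y ∈ 𝒳_t : μ_t(D(y, ζ)) ≥ β}`** of the printed proof (with
`β = b(ζ)`), the complement of the thin set of (2.6).
[cite: Bamler2023, §4.2, proof of the Proposition (closeness of nearby time-slices)] -/
def goodSet {t : I} (m : Measure (𝒳.Slice t)) (ζ β : ℝ) : Set (𝒳.Slice t) :=
  (thinSet m ζ (ENNReal.ofReal β))ᶜ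

/-- Membership in the good set. [cite: Bamler2023, §4.2, proof of the Proposition (closeness of nearby time-slices)] -/
theorem mem_goodSet {t : I} {m : Measure (𝒳.Slice t)} {ζ β : ℝ} {y : 𝒳.Slice t} :
    y ∈ goodSet m ζ β ↔ ENNReal.ofReal β ≤ m (closedBall y ζ) := by
  simp [goodSet, thinSet]

/-- **(a)**: `μ_t(𝒳_t ∖ W) ≤ ζ` when `b^{(𝒳_t,d_t,μ_t)}_1(ζ) ≥ β`, i.e.
`μ_t({y : μ_t(D(y, ζ)) < β}) ≤ ζ`. [cite: Bamler2023, §4.2, Proposition (closeness of nearby time-slices), (a)] -/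
theorem measure_compl_goodSet_le {t : I} {m : Measure (𝒳.Slice t)} {ζ β : ℝ}
    (hthin : m (thinSet m ζ (ENNReal.ofReal β)) ≤ ENNReal.ofReal ζ) :
    m (goodSet m ζ β)ᶜ ≤ ENNReal.ofReal ζ := by
  rwa [goodSet, compl_compl]

/-- The good set is nonempty as soon as `ζ < 1` (its complement has mass `≤ ζ < 1`).
[cite: Bamler2023, §4.2, proof of the Proposition (closeness of nearby time-slices)] -/
theorem goodSet_nonempty {t : I} {m : Measure (𝒳.Slice t)} [IsProbabilityMeasure m] {ζ β : ℝ}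
    (hζ1 : ζ < 1) (hthin : m (thinSet m ζ (ENNReal.ofReal β)) ≤ ENNReal.ofReal ζ) :
    (goodSet m ζ β).Nonempty := by
  by_contra hne
  rw [not_nonempty_iff_eq_empty] at hne
  have h := measure_compl_goodSet_le hthin
  rw [hne, compl_empty, measure_univ] at h
  exact absurd (h.trans_lt (ENNReal.ofReal_lt_one.2 hζ1)) (lt_irrefl 1)

/-- **(b)**, quantitative (Bamler 2023, §4.2, Proposition (b) via the Lemma (4.6) with `r = 2ζ`,
`α = δ/(4ζ²)`, `γ = β²`): for `y₁, y₂ ∈ W`,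
`d_t(y₁, y₂) ≤ d_{W₁}(ν_{y₁;s}, ν_{y₂;s}) + C(H, δ, ζ, β)`,
`C := ((δ/(2ζ) + 3√(H·δ/(4ζ²)))/β² + 4)·2ζ`, under `t − s ≤ δ`,
`∫∫ d_t dμ_t dμ_t ≤ ∫∫ d_s dμ_s dμ_s + δ` and `Var(μ_t) ≤ V` (the latter only to make
`∫∫ d_s dμ_s dμ_s` finite).
[cite: Bamler2023, §4.2, Proposition (closeness of nearby time-slices), (b), (4.5)] -/
theorem IsHConcentrated.edist_le_wassersteinW1_add_of_mem_goodSet {H : ℝ} (hH : 𝒳.IsHConcentrated H)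
    (hH0 : 0 ≤ H) {I' : Set ℝ} {μ : ∀ t : I, Measure (𝒳.Slice t)}
    (hμ : 𝒳.IsConjugateHeatFlow I' μ) {s t : I} [CompactSpace (𝒳.Slice s)] (hs : (s : ℝ) ∈ I')
    (ht : (t : ℝ) ∈ I') (hst : (s : ℝ) ≤ t) {δ ζ β V : ℝ} (hδ : 0 < δ) (hζ : 0 < ζ) (hβ : 0 < β)
    (hts : (t : ℝ) - s ≤ δ) (hVar : variance (μ t) (μ t) ≤ ENNReal.ofReal V)
    (hdiff : ∫⁻ y₁, ∫⁻ y₂, edist y₁ y₂ ∂(μ t) ∂(μ t) ≤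
      ∫⁻ x₁, ∫⁻ x₂, edist x₁ x₂ ∂(μ s) ∂(μ s) + ENNReal.ofReal δ)
    {y₁ y₂ : 𝒳.Slice t} (hy₁ : y₁ ∈ goodSet (μ t) ζ β) (hy₂ : y₂ ∈ goodSet (μ t) ζ β) :
    edist y₁ y₂ ≤ wassersteinW1 (𝒳.condKernel y₁ s) (𝒳.condKernel y₂ s) +
      ENNReal.ofReal (((δ / (2 * ζ) + 3 * Real.sqrt (H * (δ / (4 * ζ ^ 2)))) / β ^ 2 + 4) * (2 * ζ)) := by
  haveI := hμ.1 t ht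
  haveI := hμ.1 s hs
  -- finiteness of `∫∫ d_s dμ_s dμ_s` from the variance bound
  have hfin : ∫⁻ x₁, ∫⁻ x₂, edist x₁ x₂ ∂(μ s) ∂(μ s) ≠ ∞ := by
    refine ne_top_of_le_ne_top ?_ (lintegral_lintegral_edist_le_sqrt_variance (μ s) (μ s))
    refine ENNReal.rpow_ne_top_of_nonneg (by norm_num) (ne_top_of_le_ne_top ?_
      (hH.variance_le_variance_add hμ hμ hs ht hst))
    exact ENNReal.add_ne_top.2 ⟨ne_top_of_le_ne_top ENNReal.ofReal_ne_top hVar, ENNReal.ofReal_ne_top⟩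
  -- the mass bound on `B(yᵢ, 2ζ) ⊇ D(yᵢ, ζ)`
  have hball : ∀ {y : 𝒳.Slice t}, y ∈ goodSet (μ t) ζ β → ENNReal.ofReal β ≤ μ t (ball y (2 * ζ)) :=
    fun {y} hy ↦ (mem_goodSet.1 hy).trans (measure_mono (closedBall_subset_ball (by linarith)))
  have hmass : ENNReal.ofReal (β ^ 2) ≤ μ t (ball y₁ (2 * ζ)) * μ t (ball y₂ (2 * ζ)) := by
    rw [pow_two, ENNReal.ofReal_mul hβ.le]
    exact mul_le_mul' (hball hy₁) (hball hy₂)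
  refine hH.edist_le_wassersteinW1_condKernel_add hH0 hμ hs ht hst (α := δ / (4 * ζ ^ 2))
    (β := δ / (2 * ζ)) (γ := β ^ 2) (r := 2 * ζ) (by positivity) (by positivity) (by positivity)
    (by positivity) ?_ hfin ?_ hmass
  · calc (t : ℝ) - s ≤ δ := hts
      _ = δ / (4 * ζ ^ 2) * (2 * ζ) ^ 2 := by field_simp; ring
  · have h : δ / (2 * ζ) * (2 * ζ) = δ := by field_simp
    rwa [h]

/-- **(e)**, quantitative (Bamler 2023, §4.2, Proposition (e), through (c), (d) and the Lemma
(construction of `Z`) with (4.8)): with `W` the good set, `C` the constant of (b) and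
`η := max(C, max(δ, ζ))`, if `η ≤ 1/2` then
`d_{GW₁}((𝒳_s, d_s, μ_s), (𝒳_t, d_t, μ_t)) ≤ Ψ(H, V, η) =
√(Hη) + 3η + 2(√η (√(V + Hη) + √V) + 3η²)` — the (4.9)-gap `η ≥ C` holds on `W` by (b),
`t − s ≤ δ ≤ η`, `μ_t(𝒳_t ∖ W^η) ≤ μ_t(𝒳_t ∖ W) ≤ ζ ≤ η` by (a), so (4.8) applies in
`Z = 𝒳_s ⊔ 𝒳_t` and `d_{GW₁} ≤ ∫ d_Z dq` ((d), (e)).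
[cite: Bamler2023, §4.2, Proposition (closeness of nearby time-slices), (e)] -/
theorem IsHConcentrated.gromovW1_slice_le {H : ℝ} (hH : 𝒳.IsHConcentrated H)
    (hH0 : 0 ≤ H) {I' : Set ℝ} {μ : ∀ t : I, Measure (𝒳.Slice t)}
    (hμ : 𝒳.IsConjugateHeatFlow I' μ) {s t : I} [CompactSpace (𝒳.Slice s)] (hs : (s : ℝ) ∈ I')
    (ht : (t : ℝ) ∈ I') (hst : (s : ℝ) ≤ t) {δ ζ β V : ℝ} (hδ : 0 < δ) (hζ : 0 < ζ) (hβ : 0 < β)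
    (hV : 0 ≤ V) (hts : (t : ℝ) - s ≤ δ) (hVar : variance (μ t) (μ t) ≤ ENNReal.ofReal V)
    (hdiff : ∫⁻ y₁, ∫⁻ y₂, edist y₁ y₂ ∂(μ t) ∂(μ t) ≤
      ∫⁻ x₁, ∫⁻ x₂, edist x₁ x₂ ∂(μ s) ∂(μ s) + ENNReal.ofReal δ)
    (hthin : μ t (thinSet (μ t) ζ (ENNReal.ofReal β)) ≤ ENNReal.ofReal ζ)
    (hη : max (((δ / (2 * ζ) + 3 * Real.sqrt (H * (δ / (4 * ζ ^ 2)))) / β ^ 2 + 4) * (2 * ζ))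
      (max δ ζ) ≤ 1 / 2) :
    gromovW1 (μ s) (μ t) ≤
      ENNReal.ofReal (let η := max (((δ / (2 * ζ) + 3 * Real.sqrt (H * (δ / (4 * ζ ^ 2)))) / β ^ 2
          + 4) * (2 * ζ)) (max δ ζ)
        Real.sqrt (H * η) + 3 * η + 2 * (Real.sqrt η * (Real.sqrt (V + H * η) + Real.sqrt V) + 3 * η * η)) := by
  haveI := hμ.1 t ht
  set C : ℝ := ((δ / (2 * ζ) + 3 * Real.sqrt (H * (δ / (4 * ζ ^ 2)))) / β ^ 2 + 4) * (2 * ζ) with hC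
  set η : ℝ := max C (max δ ζ) with hη_def
  have hζ1 : ζ < 1 := by
    have : ζ ≤ η := (le_max_right _ _).trans (le_max_right _ _)
    linarith
  have hηpos : 0 < η := hδ.trans_le ((le_max_left _ _).trans (le_max_right _ _))
  set W : Set (𝒳.Slice t) := goodSet (μ t) ζ β with hW_def
  have hWne : W.Nonempty := goodSet_nonempty hζ1 hthin
  -- (4.9) on `W` with gap `η ≥ C`
  have h49 : ∀ w₁ ∈ W, ∀ w₂ ∈ W, edist w₁ w₂ ≤
      wassersteinW1 (𝒳.condKernel w₁ s) (𝒳.condKernel w₂ s) + ENNReal.ofReal η := by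
    intro w₁ hw₁ w₂ hw₂
    refine (hH.edist_le_wassersteinW1_add_of_mem_goodSet hH0 hμ hs ht hst hδ hζ hβ hts hVar
      hdiff hw₁ hw₂).trans (add_le_add le_rfl (ENNReal.ofReal_le_ofReal (le_max_left _ _)))
  -- the hypotheses (4.10) with `η`
  have hts' : (t : ℝ) - s ≤ η := hts.trans ((le_max_left _ _).trans (le_max_right _ _))
  have hWη : μ t (thickening η W)ᶜ ≤ ENNReal.ofReal η :=
    calc μ t (thickening η W)ᶜ ≤ μ t Wᶜ :=
          measure_mono (compl_subset_compl.2 (self_subset_thickening hηpos W))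
      _ ≤ ENNReal.ofReal ζ := measure_compl_goodSet_le hthin
      _ ≤ ENNReal.ofReal η := ENNReal.ofReal_le_ofReal ((le_max_right _ _).trans (le_max_right _ _))
  -- (e) ≤ ∫ d_Z dq ≤ Ψ
  calc gromovW1 (μ s) (μ t)
      ≤ ∫⁻ y, ∫⁻ x, edist (CrossMetricSum.inl (𝒳.sliceCost_hyp hst hWne hηpos h49) x)
          (CrossMetricSum.inr (𝒳.sliceCost_hyp hst hWne hηpos h49) y) ∂(𝒳.condKernel y s) ∂(μ t) :=
        hμ.gromovW1_le_lintegral_lintegral_sliceUnion hs ht hst hWne hηpos h49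
    _ ≤ _ := hH.lintegral_lintegral_edist_inl_inr_le_ofReal hH0 hμ hs ht hst hWne hηpos hη h49
        hts' hV hVar hWη

end MetricFlow

end Literature.Geometry.Riemannian

end
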